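import Literature.NumberTheory.Automorphic.LanglandsTunnellBridgeL2
import Literature.NumberTheory.Automorphic.ArthurClozelFibresRepData
import HarnessLib

/-!
# Tunnell's bridge: the `A_G`-normalisation discharged, assembly from five named facts
(proofs; companion to `Literature.NumberTheory.Automorphic.LanglandsTunnellBridgeL2`)

`LanglandsTunnellBridgeL2` proves the named fact
`Literature.NumberTheory.Automorphic.hasEntireContinuation_artinLFunction_of_isPiOfArtinRep`
(Tunnell, Bull. AMS 5 (1981), p. 173, ¶2: "When `π = π(ρ)` the L-series of `π` and `ρ` agree, and
since cuspidal representations have entire L-series, Artin's conjecture follows") from four named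
facts of the tree — Artin's functional equation `artin_functional_equation`, Godement–Jacquet for
`GL₂` `godementJacquet (n := 2)`, and Borel–Jacquet's dictionary `AutomorphicRepsGL.exists_isAssociatedL2`,
`hasSatakeParamAt_iff_L2` — plus one *unnamed* hypothesis (N), the `A_G`-normalisation of cuspidal
Borel–Jacquet data: every cuspidal `π` of `GL₂(𝔸_F)` has, up to a shift `q_v^{-w}`, the Satake
parameters of an `A_G`-invariant cuspidal datum `π₀` ("`π = π₀ ⊗ |det|^{w}` with `π₀` unitary",
Borel–Jacquet 1979, 5.7; "We may assume `π, π'` unitary", Arthur–Clozel 1989, Ch. 3, proof of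
Thm. 3.1).

This file **proves (N)** for `GL_n`, `n ≥ 1`, from the single named fact `cuspidal_W'_eq_bot`
(a cuspidal datum is realised on a stable complement of `W'`; Borel–Jacquet 1979, 4.6), using the
split-centre character `a ↦ a^μ` of an irreducible datum
(`AutomorphicRepData.exists_apply_posRealScalar_mul_eq_cpow`, `AutomorphicRepDataSplitCenter`), the
twist by `|det|_𝔸^{s}`, `s = -μ/(n[K:ℚ])` (`AutomorphicTwistNorm`), and the effect of the twist on
Satake parameters (`t_{π ⊗ |det|^s, v} = q_v^{-s} t_{π,v}`):

* `CuspidalAutomorphicRepData.exists_centerInvariant_satake_shift` — **(N)**: for every cuspidal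
  datum `π` of `GL_n(𝔸_K)` there are an `A_G`-invariant cuspidal datum `π₀` and `w ∈ ℂ` such that
  every Satake parameter `β` of `π₀` at any finite place `v` yields the Satake parameter
  `β · q_v^{-w}` of `π` at `v`;
* `hasEntireContinuation_artinLFunction_of_isPiOfArtinRep_of_facts` — **the bridge from five named
  facts and nothing else**: (FE) `artin_functional_equation`, (GJ) `godementJacquet (n := 2)`,
  `AutomorphicRepsGL.exists_isAssociatedL2`, `hasSatakeParamAt_iff_L2`, `cuspidal_W'_eq_bot`
  (all for `GL₂` over every number field, level and automorphic measure);
* `langlands_tunnell_hasEntireContinuation_of_cases_of_facts` — the target over `ℚ` from the three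
  cases of strong Artin and the same five facts.

Consequently the discharge `hasEntireContinuation_artinLFunction_of_isPiOfArtinRep_holds` is the
term `hasEntireContinuation_artinLFunction_of_isPiOfArtinRep_of_facts` applied to the five `_holds`
theorems of those facts, once they exist. Everything here is proved; no definition, no named fact.

## References

* J. Tunnell, *Artin's conjecture for representations of octahedral type*, Bull. AMS 5 (1981),
  p. 173 [Tunnell1981].
* A. Borel, H. Jacquet, *Automorphic forms and automorphic representations*, Proc. Sympos. Pure
  Math. 33 (1979), part 1, §4.6, 5.7 [BorelJacquetCorvallis1979].
* J. Arthur, L. Clozel, *Simple algebras, base change, and the advanced theory of the trace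
  formula*, Ann. of Math. Stud. 120 (1989), Ch. 3, proof of Thm. 3.1 [ArthurClozelAMS120].
* R. Godement, H. Jacquet, *Zeta functions of simple algebras*, LNM 260 (1972), Thm. 13.8
  [GodementJacquet1972].
-/

noncomputable section

open scoped MatrixGroups NNReal Classical
open NumberField IsDedekindDomain MeasureTheory Filter

namespace Literature.NumberTheory.Automorphic

open Literature.NumberTheory.GaloisRepresentations (HeckeCharacter ideleGroup)

/-! ### (N): the `A_G`-normalisation of a cuspidal Borel–Jacquet datum -/

section Normalisation

variable {n : ℕ} {K : Type} [Field K] [NumberField K] {hcpt : isCompact_glFiniteIntegralLevel n K}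

/-- **"We may assume `π` unitary" at the level of Satake parameters** (Borel–Jacquet 1979, 5.7:
"`π = π₀ ⊗ |det|^s` with `π₀` unitary"; Arthur–Clozel 1989, Ch. 3, proof of Thm. 3.1). Granting
`cuspidal_W'_eq_bot` (a cuspidal datum `π = W / W'` of `GL_n(𝔸_K)`, `n ≥ 1`, is realised by some
`π₁ = W₁ / ⊥` with `W₁ ⊓ W' = ⊥`, `W₁ ⊔ W' = W`): there are an `A_G`-invariant cuspidal datum `π₀`
and `w ∈ ℂ` such that whenever `β` is a Satake parameter of `π₀` at a finite place `v`, the multiset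
`β · q_v^{-w}` is a Satake parameter of `π` at `v`. Proof: `A_G` acts on `W₁` by `a ↦ a^μ`
(`AutomorphicRepData.exists_apply_posRealScalar_mul_eq_cpow`); `π₀ := π₁ ⊗ |det|_𝔸^{s}`,
`s = -μ/(n[K:ℚ])`, is cuspidal and `A_G`-invariant (`exists_cuspidalAutomorphicRepData_map_mulChar_detTwist`,
`mulChar_detTwist_apply_posRealScalar_mul_of_cpow`); untwisting by `|det|^{-s}` multiplies Satake
parameters by `q_v^{s}` (`AutomorphicRepData.HasSatakeParamAt.of_map_mulChar_detTwist_of_cpow`), and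
`π₁`, `π` have the same Satake parameters (`AutomorphicRepData.HasSatakeParamAt.of_compl`); take
`w := -s`. [cite: BorelJacquetCorvallis1979, 5.7] [cite: ArthurClozelAMS120, Ch. 3, proof of Thm. 3.1] -/
theorem CuspidalAutomorphicRepData.exists_centerInvariant_satake_shift [NeZero n]
    (hcl : cuspidal_W'_eq_bot hcpt) (π : CuspidalAutomorphicRepData n K hcpt) :
    ∃ (π₀ : CuspidalAutomorphicRepData n K hcpt) (w : ℂ),
      (∀ φ ∈ π₀.1.W, ∀ z ∈ (AdelicGroupData.gl n K).center', ∀ g, φ (z * g) = φ g) ∧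
      ∀ (v : HeightOneSpectrum (𝓞 K)) (β : Multiset ℂ), π₀.1.HasSatakeParamAt v β →
        π.1.HasSatakeParamAt v (β.map (· * (v.residueCard : ℂ) ^ (-w))) := by
  -- clean realisation `π₁ = W₁ / ⊥` and its `A_G`-character `a ↦ a^μ`
  obtain ⟨π₁, h1W', h1inf, h1sup⟩ := hcl π
  obtain ⟨μ, hμ⟩ := π₁.1.exists_apply_posRealScalar_mul_eq_cpow h1W'
  -- the normalising exponent `s₀ = -μ / (n [K:ℚ])` and the character `|·|_𝔸^{s₀}`
  have hnd : ((n * Module.finrank ℚ K : ℕ) : ℂ) ≠ 0 := by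
    exact_mod_cast (Nat.mul_ne_zero (NeZero.ne n) Module.finrank_pos.ne')
  set s₀ : ℂ := -μ / (n * Module.finrank ℚ K : ℕ) with hs₀
  have hs : s₀ * (n * Module.finrank ℚ K : ℕ) = -μ := by rw [hs₀, div_mul_cancel₀ _ hnd]
  obtain ⟨χ, hχ⟩ := exists_heckeCharacter_ideleNorm_cpow K s₀
  -- the twisted datum `π₀ = π₁ ⊗ |det|^{s₀}`
  obtain ⟨π₀, h0W, h0W'⟩ := exists_cuspidalAutomorphicRepData_map_mulChar_detTwist hχ π₁
  refine ⟨π₀, -s₀, fun φ hφ z hz g => ?_, fun v β hβ => ?_⟩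
  · -- `A_G`-invariance of the twisted forms
    rw [h0W] at hφ
    obtain ⟨φ₁, hφ₁, rfl⟩ := hφ
    obtain ⟨t, rfl⟩ := hz
    exact mulChar_detTwist_apply_posRealScalar_mul_of_cpow hχ hs (hμ φ₁ hφ₁) t g
  · -- untwist: `π₁ = π₀ ⊗ |det|^{-s₀}` has the Satake parameter `q_v^{s₀} β`, and so does `π`
    have h1W : π₁.1.W = π₀.1.W.map (mulChar (detTwist n χ⁻¹)) := by
      rw [h0W, detTwist_inv, map_mulChar_inv_map_mulChar]
    have h1W'' : π₁.1.W' = π₀.1.W'.map (mulChar (detTwist n χ⁻¹)) := by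
      rw [h0W', h1W', Submodule.map_bot, Submodule.map_bot]
    have h1 : π₁.1.HasSatakeParamAt v (β.map (((v.residueCard : ℂ) ^ (-(-s₀))) * ·)) :=
      AutomorphicRepData.HasSatakeParamAt.of_map_mulChar_detTwist_of_cpow (inv_apply_of_cpow hχ)
        h1W h1W'' hβ
    have hπ : π.1.HasSatakeParamAt v (β.map (((v.residueCard : ℂ) ^ (-(-s₀))) * ·)) :=
      AutomorphicRepData.HasSatakeParamAt.of_compl h1W' h1inf h1sup h1
    have hcomm : β.map (· * (v.residueCard : ℂ) ^ (-(-s₀))) =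
        β.map (((v.residueCard : ℂ) ^ (-(-s₀))) * ·) :=
      Multiset.map_congr rfl fun x _ => mul_comm _ _
    rw [hcomm]
    exact hπ

/-- (N) in the almost-everywhere form used by
`hasEntireContinuation_artinLFunction_of_isPiOfArtinRep_of_godementJacquet_of_isAssociatedL2`.
[cite: BorelJacquetCorvallis1979, 5.7] -/
theorem CuspidalAutomorphicRepData.exists_centerInvariant_satake_shift_eventually [NeZero n]
    (hcl : cuspidal_W'_eq_bot hcpt) (π : CuspidalAutomorphicRepData n K hcpt) :
    ∃ (π₀ : CuspidalAutomorphicRepData n K hcpt) (w : ℂ),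
      (∀ φ ∈ π₀.1.W, ∀ z ∈ (AdelicGroupData.gl n K).center', ∀ g, φ (z * g) = φ g) ∧
      ∀ᶠ v in cofinite, ∀ β : Multiset ℂ, π₀.1.HasSatakeParamAt v β →
        π.1.HasSatakeParamAt v (β.map (· * (v.residueCard : ℂ) ^ (-w))) := by
  obtain ⟨π₀, w, h₀, h⟩ := CuspidalAutomorphicRepData.exists_centerInvariant_satake_shift hcl π
  exact ⟨π₀, w, h₀, Eventually.of_forall h⟩

end Normalisation

/-! ### The bridge from five named facts -/

section Main

/-- **Tunnell's bridge from five named facts of the tree.** Assume, for `GL₂` over every number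
field (every compact-level witness, every automorphic measure): (FE) `artin_functional_equation`
(Neukirch VII (12.6)); (GJ) `godementJacquet (n := 2)` (the standard L-function of a cuspidal
`Π ≤ L²_cusp` is entire with functional equation against the contragredient; Godement–Jacquet 1972,
Thm. 13.8; for `n = 2` Jacquet–Langlands 1970, Thm. 11.1); Borel–Jacquet's dictionary between
cuspidal data and `L²_cusp` — `AutomorphicRepsGL.exists_isAssociatedL2` (an `A_G`-invariant cuspidal
datum is associated with a cuspidal subrepresentation of `L²`), `hasSatakeParamAt_iff_L2` (the two
notions of Satake parameter agree) — and `cuspidal_W'_eq_bot` (realisation on a complement of `W'`,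
Borel–Jacquet 1979, 4.6). Then `hasEntireContinuation_artinLFunction_of_isPiOfArtinRep` holds:
`π = π(σ)` almost everywhere forces `L(s, σ)` to be entire (Tunnell 1981, p. 173 ¶2). Proof:
`hasEntireContinuation_artinLFunction_of_isPiOfArtinRep_of_godementJacquet_of_isAssociatedL2` with
(N) `CuspidalAutomorphicRepData.exists_centerInvariant_satake_shift_eventually`.
[cite: Tunnell1981, p. 173] [cite: GodementJacquet1972, Thm. 13.8]
[cite: BorelJacquetCorvallis1979, §4.6 and 5.7] [cite: NeukirchANT1999, VII §12, Thm. (12.6)] -/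
theorem hasEntireContinuation_artinLFunction_of_isPiOfArtinRep_of_facts
    (hFE : ∀ (F : Type) [Field F] [NumberField F], artin_functional_equation (K := F))
    (hGJ : ∀ (F : Type) [Field F] [NumberField F]
      (μ : Measure (AdelicGroupData.gl 2 F).automorphicQuotient)
      [(AdelicGroupData.gl 2 F).IsAutomorphicMeasure μ], godementJacquet (n := 2) (K := F) (μ := μ))
    (hA : ∀ (F : Type) [Field F] [NumberField F] (hcpt : isCompact_glFiniteIntegralLevel 2 F)
      (μ : Measure (AdelicGroupData.gl 2 F).automorphicQuotient)
      [(AdelicGroupData.gl 2 F).IsAutomorphicMeasure μ], AutomorphicRepsGL.exists_isAssociatedL2 hcpt μ)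
    (hL2 : ∀ (F : Type) [Field F] [NumberField F] (hcpt : isCompact_glFiniteIntegralLevel 2 F)
      (μ : Measure (AdelicGroupData.gl 2 F).automorphicQuotient)
      [(AdelicGroupData.gl 2 F).IsAutomorphicMeasure μ], hasSatakeParamAt_iff_L2 hcpt μ)
    (hcl : ∀ (F : Type) [Field F] [NumberField F] (hcpt : isCompact_glFiniteIntegralLevel 2 F),
      cuspidal_W'_eq_bot hcpt) :
    hasEntireContinuation_artinLFunction_of_isPiOfArtinRep :=
  hasEntireContinuation_artinLFunction_of_isPiOfArtinRep_of_godementJacquet_of_isAssociatedL2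
    hFE hGJ hA hL2 @fun F _ _ hcpt π =>
      CuspidalAutomorphicRepData.exists_centerInvariant_satake_shift_eventually (hcl F hcpt) π

/-- **The target over `ℚ` from the three cases of strong Artin and the five named facts**
(`langlands_tunnell_hasEntireContinuation_of_cases` with
`hasEntireContinuation_artinLFunction_of_isPiOfArtinRep_of_facts`).
[cite: Tunnell1981, p. 173 and Theorem] [cite: LanglandsBaseChange1980, §3] -/
theorem langlands_tunnell_hasEntireContinuation_of_cases_of_facts
    (hd : strongArtin_of_isDihedralType) (ht : strongArtin_of_isTetrahedralType)
    (ho : strongArtin_of_isOctahedralType)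
    (hFE : ∀ (F : Type) [Field F] [NumberField F], artin_functional_equation (K := F))
    (hGJ : ∀ (F : Type) [Field F] [NumberField F]
      (μ : Measure (AdelicGroupData.gl 2 F).automorphicQuotient)
      [(AdelicGroupData.gl 2 F).IsAutomorphicMeasure μ], godementJacquet (n := 2) (K := F) (μ := μ))
    (hA : ∀ (F : Type) [Field F] [NumberField F] (hcpt : isCompact_glFiniteIntegralLevel 2 F)
      (μ : Measure (AdelicGroupData.gl 2 F).automorphicQuotient)
      [(AdelicGroupData.gl 2 F).IsAutomorphicMeasure μ], AutomorphicRepsGL.exists_isAssociatedL2 hcpt μ)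
    (hL2 : ∀ (F : Type) [Field F] [NumberField F] (hcpt : isCompact_glFiniteIntegralLevel 2 F)
      (μ : Measure (AdelicGroupData.gl 2 F).automorphicQuotient)
      [(AdelicGroupData.gl 2 F).IsAutomorphicMeasure μ], hasSatakeParamAt_iff_L2 hcpt μ)
    (hcl : ∀ (F : Type) [Field F] [NumberField F] (hcpt : isCompact_glFiniteIntegralLevel 2 F),
      cuspidal_W'_eq_bot hcpt) :
    langlands_tunnell_hasEntireContinuation :=
  langlands_tunnell_hasEntireContinuation_of_cases hd ht ho
    (hasEntireContinuation_artinLFunction_of_isPiOfArtinRep_of_facts hFE hGJ hA hL2 hcl)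

end Main

end Literature.NumberTheory.Automorphic

end
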